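import Literature.Probability.RandomPlanarGeometry.BrownianExitInterval
import Literature.Probability.RandomPlanarGeometry.ObliqueRBMWedgeFlow
import Literature.Probability.Process.BrownianSupTail
import Literature.Probability.Process.BrownianTimeReversal
import HarnessLib

/-!
# Small-ball bound for the running maximum of Brownian motion; second-moment tails

Topic `Literature/Probability/Process`; theorems only (plus two auxiliary measurable functionals).
Elementary quantitative facts about the canonical Brownian motion `Process.brownian`
(pre-Wiener measure) used in the one-step (Dynkin) estimates for the obliquely reflected
Brownian motion (`RandomPlanarGeometry/ObliqueRBMWedge*.lean`):

* `measure_forall_brownian_lt_le` — **small-ball bound for the one-sided running maximum**: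
  for `0 < m ≤ √s`, `P(∀ r ≤ s, B_r < m) ≤ 2 (m/√s)^{1/2}`. Proof without the reflection
  principle: if `B < m` on `[0, s]` then either the exit time `τ` of `(−a, m)` exceeds `s` — an
  event of probability `≤ E[τ ∧ s]/s ≤ max(a², m²)/s` (`integral_min_exitTime_brownian_le`,
  optional stopping of `B² − t`) — or `B` leaves `(−a, m)` at `−a`, probability `m/(m + a)`
  (gambler's ruin, `measureReal_brownianExitLeft`); take `a² = m√s`.
* `measure_sub_runMin_lt_le` — the same bound for `B_s − min_{r ≤ s} B_r` (time reversal: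
  `s ↦ B_s − B_{s−r}` is again a Brownian motion, `IsBrownianReal.reverse`, and its running
  maximum on `[0, s]` is `B_s − min_{[0,s]} B`), for ANY Brownian motion with measurable marginals
  and continuous paths on any probability space (`IsPreBrownianReal.map_path_eq` transfers the
  statement from the canonical space).
* `lintegral_sq_indicator_le_of_tail` — **second-moment tail from a fourth-order tail bound**:
  if `μ{a < S} ≤ D/a⁴` for all `a ≥ a₀ > 0` (`S ≥ 0`), then `∫ S² 1{a₀ < S} ≤ (16/3) D / a₀²`
  (dyadic shells); applied to the running supremum `runSup` of `|B|` through the tree's tail bound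
  `measure_runSup_ge_le`, `integral_runSup_sq_indicator_le`: `E[runSup_h² ; runSup_h > a₀] ≤ C h²/a₀²`.

## References

* R. Durrett, *Probability: Theory and Examples* (5th ed., 2019), Thms. 7.5.3, 7.5.5.
* D. Revuz, M. Yor, *Continuous Martingales and Brownian Motion* (1999), Ch. I Ex. (1.11), Ch. II (1.7).
-/

noncomputable section

open MeasureTheory ProbabilityTheory Filter Topology Set
open scoped NNReal ENNReal

namespace Literature.Probability.Process

open Literature.Probability.RandomPlanarGeometry

/-! ### Small-ball bound for the one-sided running maximum of the canonical Brownian motion -/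

/-- `s · P(τ > s) ≤ E[τ ∧ s]` for the exit time `τ` of the canonical Brownian motion from `(a, b)`.
[folklore] -/
theorem mul_measureReal_coe_lt_exitTime_le (a b : ℝ) (s : ℝ≥0) :
    (s : ℝ) * preWienerMeasure.real {ω | (s : WithTop ℝ≥0) < exitTime brownian a b ω} ≤
      ∫ ω, (((min (s : WithTop ℝ≥0) (exitTime brownian a b ω)).untopA : ℝ≥0) : ℝ)
        ∂preWienerMeasure := by
  haveI := isProbabilityMeasure_preWienerMeasure'
  set E := {ω : ℝ≥0 → ℝ | (s : WithTop ℝ≥0) < exitTime brownian a b ω} with hE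
  have hEm : MeasurableSet E :=
    (measurableSet_coe_lt_exitTime adapted_brownian continuous_brownian s :
      MeasurableSet[brownianFiltration s] E) |> (brownianFiltration.le s) _
  have hind : ∫ ω, E.indicator (fun _ ↦ (s : ℝ)) ω ∂preWienerMeasure =
      (s : ℝ) * preWienerMeasure.real E := by
    rw [integral_indicator_const _ hEm, smul_eq_mul, mul_comm]
  rw [← hind]
  refine integral_mono ((integrable_const (s : ℝ)).indicator hEm)
    (integrable_untopA_min_exitTime_brownian a b s) fun ω ↦ ?_
  by_cases hω : ω ∈ E
  · rw [indicator_of_mem hω]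
    have hω' : (s : WithTop ℝ≥0) < exitTime brownian a b ω := hω
    rw [min_eq_left hω'.le]
    rfl
  · rw [indicator_of_notMem hω]
    exact NNReal.coe_nonneg _

/-- **Small-ball bound for the running maximum** of the canonical Brownian motion: for
`0 < m ≤ √s`, `P(∀ r ≤ s, B_r < m) ≤ 2 √(m/√s)` (exit-time comparison with the interval
`(−a, m)`, `a² = m √s`: `P ≤ max(a²,m²)/s + m/(m+a)`). Durrett (2019), Thms. 7.5.3 and 7.5.5.
[folklore] -/
theorem measure_forall_brownian_lt_le {s : ℝ≥0} {m : ℝ} (hs : 0 < s) (hm : 0 < m)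
    (hms : m ≤ Real.sqrt s) :
    preWienerMeasure {ω | ∀ r ≤ s, brownian r ω < m} ≤
      ENNReal.ofReal (2 * Real.sqrt (m / Real.sqrt s)) := by
  haveI := isProbabilityMeasure_preWienerMeasure'
  have hs' : (0 : ℝ) < s := by exact_mod_cast hs
  have hsq : 0 < Real.sqrt s := Real.sqrt_pos.2 hs'
  set a : ℝ := Real.sqrt (m * Real.sqrt s) with ha
  have ha0 : 0 < a := Real.sqrt_pos.2 (by positivity)
  have ha2 : a ^ 2 = m * Real.sqrt s := Real.sq_sqrt (by positivity)
  have hna : -a < 0 := by linarith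
  set τ := exitTime brownian (-a) m with hτ
  -- `{∀ r ≤ s, B_r < m} ⊆ {τ > s} ∪ exitLeft`
  have hsub : {ω : ℝ≥0 → ℝ | ∀ r ≤ s, brownian r ω < m} ⊆
      {ω | (s : WithTop ℝ≥0) < τ ω} ∪ brownianExitLeft (-a) m := by
    intro ω hω
    by_cases hlt : (s : WithTop ℝ≥0) < τ ω
    · exact Or.inl hlt
    · right
      rw [not_lt] at hlt
      obtain ⟨T, hT⟩ := WithTop.ne_top_iff_exists.1 (ne_top_of_le_ne_top WithTop.coe_ne_top hlt)
      have hTs : T ≤ s := by rw [← hT] at hlt; exact WithTop.coe_le_coe.1 hlt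
      have h0 : brownian 0 ω ∈ Ioo (-a) m := by simp [ha0, hm]
      refine ⟨ne_top_of_le_ne_top WithTop.coe_ne_top hlt, ?_⟩
      rw [brownianExitValue_of_eq_coe hT.symm]
      rcases apply_eq_or_eq_of_exitTime_eq_coe (continuous_brownian ω) h0 hT.symm with h | h
      · exact h
      · exact absurd h (hω T hTs).ne
  -- the two probabilities
  have h1 : preWienerMeasure {ω | (s : WithTop ℝ≥0) < τ ω} ≤ ENNReal.ofReal (m / Real.sqrt s) := by
    have hle := (mul_measureReal_coe_lt_exitTime_le (-a) m s).trans
      (integral_min_exitTime_brownian_le hna hm s)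
    have hmax : max ((-a) ^ 2) (m ^ 2) = m * Real.sqrt s := by
      rw [neg_sq, ha2, max_eq_left]
      nlinarith [Real.sqrt_nonneg s]
    rw [hmax] at hle
    rw [← ofReal_measureReal (measure_ne_top _ _)]
    refine ENNReal.ofReal_le_ofReal ?_
    rw [le_div_iff₀ hsq]
    have hss : Real.sqrt s * Real.sqrt s = s := Real.mul_self_sqrt hs'.le
    nlinarith [measureReal_nonneg (μ := preWienerMeasure)
      (s := {ω | (s : WithTop ℝ≥0) < τ ω}), hss]
  have h2 : preWienerMeasure (brownianExitLeft (-a) m) ≤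
      ENNReal.ofReal (Real.sqrt (m / Real.sqrt s)) := by
    rw [← ofReal_measureReal (measure_ne_top _ _), measureReal_brownianExitLeft hna hm]
    refine ENNReal.ofReal_le_ofReal ?_
    -- `m/(m+a) ≤ m/a = √(m/√s)`
    have hma : m / (m - -a) ≤ m / a := by
      rw [sub_neg_eq_add]
      exact div_le_div_of_nonneg_left hm.le ha0 (by linarith)
    refine hma.trans (le_of_eq ?_)
    rw [ha, div_eq_iff ha0.ne', ← Real.sqrt_mul (by positivity)]
    rw [show m / Real.sqrt s * (m * Real.sqrt s) = m ^ 2 by field_simp]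
    exact (Real.sqrt_sq hm.le).symm
  have hcomp : m / Real.sqrt s ≤ Real.sqrt (m / Real.sqrt s) := by
    have hx : m / Real.sqrt s ≤ 1 := (div_le_one hsq).2 hms
    have hx0 : 0 ≤ m / Real.sqrt s := by positivity
    calc m / Real.sqrt s = Real.sqrt (m / Real.sqrt s) * Real.sqrt (m / Real.sqrt s) :=
          (Real.mul_self_sqrt hx0).symm
      _ ≤ Real.sqrt (m / Real.sqrt s) * 1 :=
          mul_le_mul_of_nonneg_left (Real.sqrt_le_one.2 hx) (Real.sqrt_nonneg _)
      _ = _ := mul_one _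
  calc preWienerMeasure {ω | ∀ r ≤ s, brownian r ω < m}
      ≤ preWienerMeasure ({ω | (s : WithTop ℝ≥0) < τ ω} ∪ brownianExitLeft (-a) m) :=
        measure_mono hsub
    _ ≤ preWienerMeasure {ω | (s : WithTop ℝ≥0) < τ ω} +
          preWienerMeasure (brownianExitLeft (-a) m) := measure_union_le _ _
    _ ≤ ENNReal.ofReal (m / Real.sqrt s) + ENNReal.ofReal (Real.sqrt (m / Real.sqrt s)) :=
        add_le_add h1 h2
    _ ≤ ENNReal.ofReal (Real.sqrt (m / Real.sqrt s)) +
          ENNReal.ofReal (Real.sqrt (m / Real.sqrt s)) := by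
        gcongr
    _ = ENNReal.ofReal (2 * Real.sqrt (m / Real.sqrt s)) := by
        rw [← ENNReal.ofReal_add (Real.sqrt_nonneg _) (Real.sqrt_nonneg _), two_mul]

/-! ### Path functionals: the dyadic running maximum and the transfer to a general Brownian motion -/

/-- The running maximum over the dyadic grid of `[0, s]` of a raw path `p : ℝ≥0 → ℝ`:
`⨆ (n,k) p (dyadTime s n k)`; a measurable functional of the path, equal to `max_{[0,s]} p` for
continuous `p`. [folklore] -/
def pathRunMax (s : ℝ≥0) (p : ℝ≥0 → ℝ) : ℝ := ⨆ q : ℕ × ℕ, p (dyadTime s q.1 q.2)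

/-- `pathRunMax s` is measurable for the product σ-algebra. [folklore] -/
theorem measurable_pathRunMax (s : ℝ≥0) : Measurable (pathRunMax s) :=
  Measurable.iSup fun q ↦ measurable_pi_apply (dyadTime s q.1 q.2)

/-- For a continuous path, `pathRunMax s p < m ↔ ∀ r ≤ s, p r < m`. [folklore] -/
theorem pathRunMax_lt_iff {s : ℝ≥0} {p : ℝ≥0 → ℝ} (hp : Continuous p) {m : ℝ} :
    pathRunMax s p < m ↔ ∀ r ≤ s, p r < m := by
  have hbdd : BddAbove (range fun q : ℕ × ℕ ↦ p (dyadTime s q.1 q.2)) := by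
    obtain ⟨C, hC⟩ := (isCompact_Iic_nnreal s).bddAbove_image hp.continuousOn
    exact ⟨C, by rintro _ ⟨q, rfl⟩; exact hC ⟨dyadTime s q.1 q.2, dyadTime_le s q.1 q.2, rfl⟩⟩
  constructor
  · intro h r hr
    have hle : p r ≤ pathRunMax s p :=
      le_of_forall_dyadTime_le hp (fun n k ↦ le_ciSup hbdd (n, k)) hr
    exact hle.trans_lt h
  · intro h
    -- the sup is attained-bounded by the value at some point: use compactness (max exists)
    obtain ⟨r₀, hr₀, hmax⟩ := (isCompact_Iic_nnreal s).exists_isMaxOn nonempty_Iic hp.continuousOn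
    have : pathRunMax s p ≤ p r₀ := ciSup_le fun q ↦ hmax (dyadTime_le s q.1 q.2)
    exact this.trans_lt (h r₀ hr₀)

/-- **Transfer to a general Brownian motion.** For a pre-Brownian motion `X` with measurable
marginals and continuous paths on any probability space, `P(∀ r ≤ s, X_r < m)` equals the
canonical `P(∀ r ≤ s, B_r < m)` (both are the probability of the measurable path event
`{pathRunMax s < m}` under the common law of the paths). [folklore] -/
theorem measure_forall_lt_eq_of_isPreBrownianReal {Ω : Type*} {mΩ : MeasurableSpace Ω}
    {P : Measure Ω} {X : ℝ≥0 → Ω → ℝ} (hX : IsPreBrownianReal X P) (hXm : ∀ t, Measurable (X t))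
    (hXc : ∀ ω, Continuous (X · ω)) (s : ℝ≥0) (m : ℝ) :
    P {ω | ∀ r ≤ s, X r ω < m} = preWienerMeasure {ω | ∀ r ≤ s, brownian r ω < m} := by
  have hlaw := hX.map_path_eq isPreBrownianReal_brownian hXm measurable_brownian
  have hE : MeasurableSet {p : ℝ≥0 → ℝ | pathRunMax s p < m} :=
    measurableSet_lt (measurable_pathRunMax s) measurable_const
  have h1 : {ω | ∀ r ≤ s, X r ω < m} = (fun ω t ↦ X t ω) ⁻¹' {p | pathRunMax s p < m} := by
    ext ω
    simp only [mem_setOf_eq, mem_preimage]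
    exact (pathRunMax_lt_iff (hXc ω)).symm
  have h2 : {ω | ∀ r ≤ s, brownian r ω < m} =
      (fun ω t ↦ brownian t ω) ⁻¹' {p | pathRunMax s p < m} := by
    ext ω
    simp only [mem_setOf_eq, mem_preimage]
    exact (pathRunMax_lt_iff (continuous_brownian ω)).symm
  rw [h1, h2, ← Measure.map_apply (measurable_pi_lambda _ hXm) hE,
    ← Measure.map_apply (measurable_pi_lambda _ measurable_brownian) hE, hlaw]

/-- **Small-ball bound for the running maximum of any Brownian motion** with measurable
marginals and continuous paths: `P(∀ r ≤ s, X_r < m) ≤ 2 √(m/√s)` for `0 < m ≤ √s`. [folklore] -/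
theorem measure_forall_lt_le_of_isPreBrownianReal {Ω : Type*} {mΩ : MeasurableSpace Ω}
    {P : Measure Ω} {X : ℝ≥0 → Ω → ℝ} (hX : IsPreBrownianReal X P) (hXm : ∀ t, Measurable (X t))
    (hXc : ∀ ω, Continuous (X · ω)) {s : ℝ≥0} {m : ℝ} (hs : 0 < s) (hm : 0 < m)
    (hms : m ≤ Real.sqrt s) :
    P {ω | ∀ r ≤ s, X r ω < m} ≤ ENNReal.ofReal (2 * Real.sqrt (m / Real.sqrt s)) := by
  rw [measure_forall_lt_eq_of_isPreBrownianReal hX hXm hXc]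
  exact measure_forall_brownian_lt_le hs hm hms

/-! ### The reflected value `X_s − min_{[0,s]} X` -/

/-- **Small-ball bound for `X_s − min_{r ≤ s} X_r`** (the value at time `s` of the path reflected
at its running minimum — a reflected Brownian motion): for a Brownian motion `X` with measurable
marginals and continuous paths, `P(∀ r ≤ s, X_s − X_r < m) ≤ 2 √(m/√s)` for `0 < m ≤ √s`.
Time reversal: `r ↦ X_s − X_{s−r}` (continued after `s`) is `−`(the reversed Brownian motion of
`IsPreBrownianReal.reverse`), again a Brownian motion, whose running maximum on `[0, s]` is
`X_s − min_{[0,s]} X`. [folklore] -/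
theorem measure_forall_sub_lt_le_of_isPreBrownianReal {Ω : Type*} {mΩ : MeasurableSpace Ω}
    {P : Measure Ω} {X : ℝ≥0 → Ω → ℝ} (hX : IsPreBrownianReal X P) (hXm : ∀ t, Measurable (X t))
    (hXc : ∀ ω, Continuous (X · ω)) {s : ℝ≥0} {m : ℝ} (hs : 0 < s) (hm : 0 < m)
    (hms : m ≤ Real.sqrt s) :
    P {ω | ∀ r ≤ s, X s ω - X r ω < m} ≤ ENNReal.ofReal (2 * Real.sqrt (m / Real.sqrt s)) := by
  -- the negated reversed process
  set Y : ℝ≥0 → Ω → ℝ := fun r ω ↦ -(X (s - r) ω + X (max s r) ω - 2 * X s ω) with hY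
  have hYpre : IsPreBrownianReal Y P := (hX.reverse s).neg
  have hYm : ∀ t, Measurable (Y t) := fun t ↦ (measurable_reverse hXm s t).neg
  have hYc : ∀ ω, Continuous (Y · ω) := fun ω ↦ (continuous_reverse (hXc ω) s).neg
  have hset : {ω | ∀ r ≤ s, X s ω - X r ω < m} = {ω | ∀ r ≤ s, Y r ω < m} := by
    ext ω
    simp only [mem_setOf_eq, hY]
    constructor
    · intro h r hr
      rw [max_eq_left hr]
      have := h (s - r) tsub_le_self
      linarith
    · intro h r hr
      have := h (s - r) tsub_le_self
      rw [max_eq_left tsub_le_self, tsub_tsub_cancel_of_le hr] at this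
      linarith
  rw [hset]
  exact measure_forall_lt_le_of_isPreBrownianReal hYpre hYm hYc hs hm hms

/-! ### Second-moment tails from a fourth-order tail bound -/

/-- **Dyadic-shell bound.** If `S ≥ 0` is measurable and `μ{a < S} ≤ D/a⁴` (as `ENNReal.ofReal`)
for every `a ≥ a₀ > 0`, then `∫⁻ S² 1{a₀ < S} ≤ (16/3) D/a₀²`: pointwise
`S² 1{a₀ < S} ≤ ∑ⱼ (2^{j+1} a₀)² 1{2ʲ a₀ < S}`, and `∑ⱼ 4^{j+1} a₀² D/(2ʲa₀)⁴ = (16/3) D/a₀²`.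
[folklore] -/
theorem lintegral_sq_indicator_le_of_tail {α : Type*} {mα : MeasurableSpace α} {μ : Measure α}
    {S : α → ℝ} (hS : Measurable S) (hS0 : ∀ x, 0 ≤ S x) {a₀ D : ℝ} (ha₀ : 0 < a₀) (hD : 0 ≤ D)
    (htail : ∀ a : ℝ, a₀ ≤ a → μ {x | a < S x} ≤ ENNReal.ofReal (D / a ^ 4)) :
    ∫⁻ x, ENNReal.ofReal (S x ^ 2 * {x | a₀ < S x}.indicator 1 x) ∂μ ≤
      ENNReal.ofReal (16 / 3 * D / a₀ ^ 2) := by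
  -- pointwise domination by the dyadic shells
  have hpt : ∀ x, ENNReal.ofReal (S x ^ 2 * {x | a₀ < S x}.indicator 1 x) ≤
      ∑' j : ℕ, ENNReal.ofReal ((2 ^ (j + 1) * a₀) ^ 2) * {x | 2 ^ j * a₀ < S x}.indicator 1 x := by
    intro x
    by_cases hx : a₀ < S x
    · -- `S x ∈ (2^j a₀, 2^{j+1} a₀]` for `j = ⌊log₂ (S x / a₀)⌋`, found by `Nat.find` on `S x ≤ 2^{j+1} a₀`
      have hex : ∃ j : ℕ, S x ≤ 2 ^ (j + 1) * a₀ := by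
        obtain ⟨j, hj⟩ := pow_unbounded_of_one_lt (S x / a₀) one_lt_two
        refine ⟨j, ?_⟩
        rw [div_lt_iff₀ ha₀] at hj
        have : (2 : ℝ) ^ j * a₀ ≤ 2 ^ (j + 1) * a₀ := by
          rw [pow_succ]; nlinarith [pow_pos (two_pos : (0:ℝ) < 2) j]
        linarith
      classical
      set j := Nat.find hex with hj
      have hj1 : S x ≤ 2 ^ (j + 1) * a₀ := Nat.find_spec hex
      have hj0 : 2 ^ j * a₀ < S x := by
        rcases Nat.eq_zero_or_pos j with h0 | hpos
        · rw [h0, pow_zero, one_mul]; exact hx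
        · have := Nat.find_min hex (m := j - 1) (by omega)
          rw [not_le] at this
          rwa [show j - 1 + 1 = j by omega] at this
      refine le_trans ?_ (ENNReal.le_tsum j)
      rw [indicator_of_mem (by exact hx), indicator_of_mem (by exact hj0), Pi.one_apply, mul_one,
        Pi.one_apply, mul_one]
      exact ENNReal.ofReal_le_ofReal (by
        have := hS0 x
        nlinarith)
    · rw [indicator_of_notMem (by exact hx), mul_zero, ENNReal.ofReal_zero]
      exact bot_le
  -- integrate and sum the geometric series
  calc ∫⁻ x, ENNReal.ofReal (S x ^ 2 * {x | a₀ < S x}.indicator 1 x) ∂μ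
      ≤ ∫⁻ x, ∑' j : ℕ, ENNReal.ofReal ((2 ^ (j + 1) * a₀) ^ 2) *
          {x | 2 ^ j * a₀ < S x}.indicator 1 x ∂μ := lintegral_mono hpt
    _ = ∑' j : ℕ, ENNReal.ofReal ((2 ^ (j + 1) * a₀) ^ 2) * μ {x | 2 ^ j * a₀ < S x} := by
        have hms : ∀ j : ℕ, MeasurableSet {x | (2 : ℝ) ^ j * a₀ < S x} := fun j ↦
          measurableSet_lt measurable_const hS
        have hfun : ∀ j : ℕ, (fun x ↦ ENNReal.ofReal ((2 ^ (j + 1) * a₀) ^ 2) *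
            {x | (2 : ℝ) ^ j * a₀ < S x}.indicator 1 x) =
            {x | (2 : ℝ) ^ j * a₀ < S x}.indicator fun _ ↦ ENNReal.ofReal ((2 ^ (j + 1) * a₀) ^ 2) := by
          intro j
          funext x
          by_cases hx : x ∈ {x | (2 : ℝ) ^ j * a₀ < S x}
          · rw [indicator_of_mem hx, indicator_of_mem hx, Pi.one_apply, mul_one]
          · rw [indicator_of_notMem hx, indicator_of_notMem hx, mul_zero]
        rw [lintegral_tsum fun j ↦ ?_]
        · congr 1
          ext j
          rw [hfun j, lintegral_indicator_const (hms j)]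
        · rw [hfun j]
          exact (measurable_const.indicator (hms j)).aemeasurable
    _ ≤ ∑' j : ℕ, ENNReal.ofReal ((2 ^ (j + 1) * a₀) ^ 2) * ENNReal.ofReal (D / (2 ^ j * a₀) ^ 4) := by
        refine ENNReal.tsum_le_tsum fun j ↦ mul_le_mul_right (htail _ ?_) _
        have : (1 : ℝ) ≤ 2 ^ j := one_le_pow₀ (by norm_num)
        nlinarith
    _ = ∑' j : ℕ, ENNReal.ofReal (4 * D / a₀ ^ 2 * (1 / 4) ^ j) := by
        congr 1
        ext j
        rw [← ENNReal.ofReal_mul (by positivity)]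
        congr 1
        set q : ℝ := 2 ^ j with hq
        have hq0 : q ≠ 0 := by positivity
        have h4 : (1 / 4 : ℝ) ^ j = 1 / q ^ 2 := by
          rw [one_div_pow, hq, ← pow_mul, show (4 : ℝ) = 2 ^ 2 by norm_num, ← pow_mul, mul_comm]
        rw [pow_succ, h4]
        field_simp
        ring
    _ = ENNReal.ofReal (16 / 3 * D / a₀ ^ 2) := by
        rw [← ENNReal.ofReal_tsum_of_nonneg (fun j ↦ by positivity)]
        · congr 1
          rw [tsum_mul_left, tsum_geometric_of_lt_one (by norm_num) (by norm_num)]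
          ring
        · exact (summable_geometric_of_lt_one (by norm_num) (by norm_num)).mul_left _

/-- Tail of the running supremum of `|B|` in the form `P(a < runSup h) ≤ (512/9) h²/a⁴` for
`a ≥ 4√h` (from `measure_runSup_ge_le`: `(a/2)² − h ≥ 3a²/16`). [folklore] -/
theorem measure_lt_runSup_le (h : ℝ≥0) {a : ℝ} (ha : 4 * Real.sqrt h ≤ a) (ha0 : 0 < a) :
    preWienerMeasure {ω | a < runSup h ω} ≤ ENNReal.ofReal (512 / 9 * (h : ℝ) ^ 2 / a ^ 4) := by
  have hh : (0 : ℝ) ≤ h := h.coe_nonneg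
  have hsq : Real.sqrt (h : ℝ) ^ 2 = h := Real.sq_sqrt hh
  have h16 : (16 : ℝ) * h ≤ a ^ 2 := by nlinarith [Real.sqrt_nonneg (h : ℝ)]
  have hlt : (h : ℝ) < (a / 2) ^ 2 := by nlinarith
  refine (measure_mono fun ω (hω : a < runSup h ω) ↦ hω.le).trans
    ((measure_runSup_ge_le h ha0.le hlt).trans (ENNReal.ofReal_le_ofReal ?_))
  have hden : 3 * a ^ 2 / 16 ≤ (a / 2) ^ 2 - h := by nlinarith
  have hden0 : 0 < 3 * a ^ 2 / 16 := by positivity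
  calc 2 * (h : ℝ) ^ 2 / ((a / 2) ^ 2 - h) ^ 2 ≤ 2 * (h : ℝ) ^ 2 / (3 * a ^ 2 / 16) ^ 2 := by
        gcongr
    _ = 512 / 9 * (h : ℝ) ^ 2 / a ^ 4 := by
        field_simp
        ring

/-- **Second-moment tail of the running supremum**: for `a₀ ≥ 4√h`, `a₀ > 0`,
`E[runSup_h² ; a₀ < runSup_h] ≤ (8192/27) h²/a₀²`. [folklore] -/
theorem lintegral_runSup_sq_indicator_le (h : ℝ≥0) {a₀ : ℝ} (ha : 4 * Real.sqrt h ≤ a₀)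
    (ha0 : 0 < a₀) :
    ∫⁻ ω, ENNReal.ofReal (runSup h ω ^ 2 * {ω | a₀ < runSup h ω}.indicator 1 ω) ∂preWienerMeasure ≤
      ENNReal.ofReal (16 / 3 * (512 / 9 * (h : ℝ) ^ 2) / a₀ ^ 2) :=
  lintegral_sq_indicator_le_of_tail (measurable_runSup h) (runSup_nonneg h) ha0 (by positivity)
    fun a haa ↦ measure_lt_runSup_le h (ha.trans haa) (ha0.trans_le haa)

/-! ### Linear combinations of the two canonical Brownian motions of the pair space -/

section Pair

/-- Finite-dimensional laws of the first coordinate process of the pair: those of Brownian motion.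
[folklore] -/
theorem isPreBrownianReal_brownian_fst :
    IsPreBrownianReal (fun t (ω : WienerPair) ↦ brownian t ω.1) wienerPair := by
  haveI := isProbabilityMeasure_preWienerMeasure'
  refine ⟨fun I ↦ ⟨(measurable_pi_lambda _ fun t ↦
    (measurable_brownian _).comp measurable_fst).aemeasurable, ?_⟩⟩
  have h := (isPreBrownianReal_brownian.hasLaw I).map_eq
  have hm : Measurable (fun ω₁ : ℝ≥0 → ℝ ↦ I.restrict fun t ↦ brownian t ω₁) :=
    (Finset.measurable_restrict I).comp (measurable_pi_lambda _ measurable_brownian)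
  have hcomp : (fun ω : WienerPair ↦ I.restrict fun t ↦ brownian t ω.1) =
      (fun ω₁ : ℝ≥0 → ℝ ↦ I.restrict fun t ↦ brownian t ω₁) ∘ Prod.fst := rfl
  rw [hcomp, ← Measure.map_map hm measurable_fst,
    wienerPair, Measure.map_fst_prod, measure_univ, one_smul, h]

/-- Finite-dimensional laws of the second coordinate process of the pair. [folklore] -/
theorem isPreBrownianReal_brownian_snd :
    IsPreBrownianReal (fun t (ω : WienerPair) ↦ brownian t ω.2) wienerPair := by
  haveI := isProbabilityMeasure_preWienerMeasure'
  refine ⟨fun I ↦ ⟨(measurable_pi_lambda _ fun t ↦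
    (measurable_brownian _).comp measurable_snd).aemeasurable, ?_⟩⟩
  have h := (isPreBrownianReal_brownian.hasLaw I).map_eq
  have hm : Measurable (fun ω₂ : ℝ≥0 → ℝ ↦ I.restrict fun t ↦ brownian t ω₂) :=
    (Finset.measurable_restrict I).comp (measurable_pi_lambda _ measurable_brownian)
  have hcomp : (fun ω : WienerPair ↦ I.restrict fun t ↦ brownian t ω.2) =
      (fun ω₂ : ℝ≥0 → ℝ ↦ I.restrict fun t ↦ brownian t ω₂) ∘ Prod.snd := rfl
  rw [hcomp, ← Measure.map_map hm measurable_snd,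
    wienerPair, Measure.map_snd_prod, measure_univ, one_smul, h]

/-- The **linear combination** `a B¹ + b B²` of the two coordinates of the pair. [folklore] -/
def pairComb (a b : ℝ) (t : ℝ≥0) (ω : WienerPair) : ℝ := a * brownian t ω.1 + b * brownian t ω.2

/-- Measurability of the marginals of `a B¹ + b B²`. [folklore] -/
theorem measurable_pairComb (a b : ℝ) (t : ℝ≥0) : Measurable (pairComb a b t) := by
  unfold pairComb
  have h1 : Measurable fun ω : WienerPair ↦ brownian t ω.1 := (measurable_brownian t).comp measurable_fst
  have h2 : Measurable fun ω : WienerPair ↦ brownian t ω.2 := (measurable_brownian t).comp measurable_snd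
  fun_prop

/-- Continuity of every path of `a B¹ + b B²`. [folklore] -/
theorem continuous_pairComb (a b : ℝ) (ω : WienerPair) : Continuous (pairComb a b · ω) := by
  unfold pairComb
  have h1 := continuous_brownian ω.1
  have h2 := continuous_brownian ω.2
  fun_prop

/-- `a B¹ + b B²` is a Gaussian process on the pair space (independent Gaussian coordinates).
[folklore] -/
theorem isGaussianProcess_pairComb (a b : ℝ) : IsGaussianProcess (pairComb a b) wienerPair := by
  haveI := isProbabilityMeasure_preWienerMeasure'
  refine ⟨fun I ↦ ?_⟩
  set X : WienerPair → (I → ℝ) := fun ω ↦ a • I.restrict fun t ↦ brownian t ω.1 with hX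
  set Y : WienerPair → (I → ℝ) := fun ω ↦ b • I.restrict fun t ↦ brownian t ω.2 with hY
  have hXg : HasGaussianLaw X wienerPair :=
    (isPreBrownianReal_brownian_fst.isGaussianProcess.hasGaussianLaw I).fun_smul a
  have hYg : HasGaussianLaw Y wienerPair :=
    (isPreBrownianReal_brownian_snd.isGaussianProcess.hasGaussianLaw I).fun_smul b
  have hind : IndepFun X Y wienerPair := by
    have := indepFun_prod (μ := preWienerMeasure) (ν := preWienerMeasure)
      (X := fun ω₁ : ℝ≥0 → ℝ ↦ a • I.restrict fun t ↦ brownian t ω₁)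
      (Y := fun ω₂ : ℝ≥0 → ℝ ↦ b • I.restrict fun t ↦ brownian t ω₂)
      (((Finset.measurable_restrict I).comp (measurable_pi_lambda _ measurable_brownian)).const_smul a)
      (((Finset.measurable_restrict I).comp (measurable_pi_lambda _ measurable_brownian)).const_smul b)
    exact this
  have hsum := (hind.hasGaussianLaw hXg hYg).add
  have heq : X + Y = fun ω ↦ I.restrict fun t ↦ pairComb a b t ω := by
    funext ω
    ext t
    simp [hX, hY, pairComb]
  rwa [heq] at hsum

/-- `a B¹ + b B²` is centred. [folklore] -/
theorem integral_pairComb (a b : ℝ) (t : ℝ≥0) : ∫ ω, pairComb a b t ω ∂wienerPair = 0 := by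
  unfold pairComb
  rw [integral_add ((integrable_brownian_fst_pow t 1).const_mul a |>.congr (by simp))
    ((integrable_brownian_snd_pow t 1).const_mul b |>.congr (by simp)),
    integral_const_mul, integral_const_mul, integral_brownian_fst, integral_brownian_snd]
  ring

/-- Covariance of `a B¹ + b B²`: `(a² + b²) min(s, t)`. [folklore] -/
theorem covariance_pairComb (a b : ℝ) (s t : ℝ≥0) :
    cov[pairComb a b s, pairComb a b t; wienerPair] = (a ^ 2 + b ^ 2) * min s t := by
  haveI := isProbabilityMeasure_preWienerMeasure'
  have hB1 := isPreBrownianReal_brownian_fst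
  have hB2 := isPreBrownianReal_brownian_snd
  have m1 : ∀ r, MemLp (fun ω : WienerPair ↦ brownian r ω.1) 2 wienerPair := fun r ↦
    (hB1.isGaussianProcess.hasGaussianLaw_eval r).memLp_two
  have m2 : ∀ r, MemLp (fun ω : WienerPair ↦ brownian r ω.2) 2 wienerPair := fun r ↦
    (hB2.isGaussianProcess.hasGaussianLaw_eval r).memLp_two
  have hind : ∀ r r', IndepFun (fun ω : WienerPair ↦ brownian r ω.1)
      (fun ω : WienerPair ↦ brownian r' ω.2) wienerPair := fun r r' ↦
    indepFun_prod (μ := preWienerMeasure) (ν := preWienerMeasure) (measurable_brownian r)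
      (measurable_brownian r')
  have h12 : ∀ r r', cov[fun ω : WienerPair ↦ brownian r ω.1, fun ω : WienerPair ↦ brownian r' ω.2;
      wienerPair] = 0 := fun r r' ↦ (hind r r').covariance_eq_zero (m1 r) (m2 r')
  have h21 : ∀ r r', cov[fun ω : WienerPair ↦ brownian r ω.2, fun ω : WienerPair ↦ brownian r' ω.1;
      wienerPair] = 0 := fun r r' ↦ by rw [covariance_comm]; exact h12 r' r
  have hf : ∀ r, pairComb a b r = (fun ω : WienerPair ↦ a * brownian r ω.1) +
      fun ω : WienerPair ↦ b * brownian r ω.2 := fun r ↦ rfl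
  rw [hf s, hf t, covariance_add_left ((m1 s).const_mul a) ((m2 s).const_mul b)
      (((m1 t).const_mul a).add ((m2 t).const_mul b)),
    covariance_add_right ((m1 s).const_mul a) ((m1 t).const_mul a) ((m2 t).const_mul b),
    covariance_add_right ((m2 s).const_mul b) ((m1 t).const_mul a) ((m2 t).const_mul b)]
  simp only [covariance_const_mul_left, covariance_const_mul_right, hB1.covariance_fun_eval,
    hB2.covariance_fun_eval, h12, h21]
  ring

/-- **A normalised linear combination `a B¹ + b B²` (`a² + b² = 1`) of the two independent
Brownian motions of the pair space is a Brownian motion** (Gaussian, centred, covariance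
`min(s,t)`, continuous paths). Revuz–Yor (1999), Ch. I Ex. (1.11). [folklore] -/
theorem isBrownianReal_pairComb {a b : ℝ} (hab : a ^ 2 + b ^ 2 = 1) :
    IsBrownianReal (pairComb a b) wienerPair where
  toIsPreBrownianReal := by
    refine (isGaussianProcess_pairComb a b).isPreBrownianReal_of_covariance (integral_pairComb a b)
      fun s t hst ↦ ?_
    rw [covariance_pairComb, hab, one_mul, min_eq_left hst]
  cont := ae_of_all _ (continuous_pairComb a b)

end Pair

end Literature.Probability.Process
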